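import Mathlib.Analysis.SpecialFunctions.Log.Basic
import Mathlib.Analysis.Calculus.ContDiff.Basic
import HarnessLib

/-!
# Weyl–Papapetrou orbit-space data of a stationary axisymmetric vacuum black hole exterior

Topic `Literature/Geometry/Lorentzian` (Mathlib only). Definition request
`defn-CircularStationaryOrbitData` of route `FinalStateConjecture/ZeroEnergyKerrOrBomb` (D2:
"Weyl–Papapetrou / Ernst orbit-space data (λ = g(T,T), twist ω, ρ, Ξ) and the zero-energy optical
metric J = λq/ρ² for a spacetime with ℝ×U(1) isometry").

Source: P. T. Chruściel, J. L. Costa, *On uniqueness of stationary vacuum black holes*,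
Astérisque 321 (2008) 195–265 (arXiv:0806.0016), §6.4 "Global coordinates on ⟨⟨M⟩⟩": on the
domain of outer communications minus the axis the metric has the global coordinate representation
`⁴g = −ρ² e^{2λ} dt² + e^{−2λ} (dφ − v dt)² + e^{2û} (dρ² + dz²)` for some functions `v(ρ,z)`,
`λ(ρ,z)`, `û`, with `ρ > 0`, `z ∈ ℝ` the Weyl coordinates (`ρ` harmonic on the orbit space, `z` a
harmonic conjugate, §6.3); `U = λ + ln ρ`, `g(∂_φ, ∂_φ) = ρ² e^{−2U} = e^{−2λ}`; the twist potential
`ω`, `dω = ⋆(dY ∧ Y)`; and the Ernst pair `Φ = (λ, ω) : ℝ³ ∖ 𝒜 → ℍ²`, `b = dλ² + e^{4λ} dω²`.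

This file records that COORDINATE-LEVEL data as a structure on the open half-plane
`{(ρ, z) : ρ > 0}` and DERIVES the orbit-space quantities used by the route's card
(`zero-energy-optics-kerr-or-bomb`): the Gram functions `g_tt = g(T,T)` (the card's "λ"),
`g_tφ = g(T,Φ)` ("W"), `g_φφ = g(Φ,Φ)` ("X"), the identity `W² − g_tt·X = ρ²` (PROVED,
`gram_det`), `Ξ := X/ρ²`, the conformal factor `e^{2u} := g_tt · Ξ` and the zero-energy optical
conformal factor `g_tt e^{2û} / ρ²` (so that `J = (g_tt/ρ²) q`, `q = e^{2û}(dρ² + dz²)`, on the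
region `E₂ = {g_tt > 0}` where `T` is spacelike, i.e. the ergoregion). The card's identities (F)
funnel law, (S) superharmonicity of `u`, (B) Hill-wall model are statements of the ROUTE about these
objects, not printed literature results; they are not vendored here (recommend route items).

## Conventions

* `lam` is Chruściel–Costa's `λ` (so `g_φφ = e^{−2λ}`), NOT the card's `λ = g(T,T)` (here `gtt`).
* Killing fields `T = ∂_t`, `Φ = ∂_φ`; signature `(−,+,+,+)`; vacuum is not assumed by the structure
  (the Ernst equations are a separate predicate one may add); smoothness `C^∞` on `{ρ > 0}`.

## References

* P. T. Chruściel, J. L. Costa, Astérisque 321 (2008) 195–265 = arXiv:0806.0016, §6.3–6.4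
  (Weyl coordinates, global representation (6.11)-type display, `U = λ + ln ρ`, twist potential,
  Ernst map). [ChruscielCosta2008]
* G. Weinstein, Comm. Pure Appl. Math. 43 (1990) 903–948; M. Heusler, *Black hole uniqueness
  theorems* (1996), Ch. 3–4 (background, cited in the request; not re-read).
-/

noncomputable section

open scoped ContDiff

namespace Literature.Geometry.Lorentzian

/-- The open Weyl half-plane `{(ρ, z) : ρ > 0}` (orbit space minus the axis).
[cite: ChruscielCosta2008, §6.3–6.4 (Weyl coordinates (ρ, z))] -/
def weylHalfPlane : Set (ℝ × ℝ) := {p | 0 < p.1}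

/-- **Weyl–Papapetrou data** (Chruściel–Costa 2008, §6.4): smooth functions `v`, `λ`, `û` of
`(ρ, z)`, `ρ > 0`, such that the stationary axisymmetric metric reads
`⁴g = −ρ² e^{2λ} dt² + e^{−2λ}(dφ − v dt)² + e^{2û}(dρ² + dz²)`, together with a scalar twist
potential `ω(ρ, z)` (Chruściel–Costa reduce along the AXIAL field, `dω = ⋆(dY ∧ Y)`; the route's card
uses the Ehlers reduction along `T`, i.e. the twist of `T` — the structure records one smooth potential
and does not fix which reduction it belongs to). Only `C^∞` smoothness (exponent `∞ : ℕ∞`, not `ω`) on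
the open half-plane is built in; the field equations and boundary behaviour are separate hypotheses.
[cite: ChruscielCosta2008, §6.4 (global coordinate representation; twist potential)] -/
structure WeylPapapetrouData where
  /-- the "shift" `v(ρ,z)` in `dφ − v dt` -/
  v : ℝ × ℝ → ℝ
  /-- Chruściel–Costa's `λ(ρ,z)`: `g(∂_φ,∂_φ) = e^{−2λ}` -/
  lam : ℝ × ℝ → ℝ
  /-- the conformal factor exponent `û(ρ,z)` of the orbit metric `e^{2û}(dρ² + dz²)` -/
  uHat : ℝ × ℝ → ℝ
  /-- a twist potential `ω(ρ,z)` (of the Killing field used for the reduction: axial for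
  Chruściel–Costa, `T` for the Ehlers reduction of the route's card) -/
  twist : ℝ × ℝ → ℝ
  v_smooth : ContDiffOn ℝ ∞ v weylHalfPlane
  lam_smooth : ContDiffOn ℝ ∞ lam weylHalfPlane
  uHat_smooth : ContDiffOn ℝ ∞ uHat weylHalfPlane
  twist_smooth : ContDiffOn ℝ ∞ twist weylHalfPlane

namespace WeylPapapetrouData

variable (D : WeylPapapetrouData)

/-- `g_φφ = g(Φ, Φ) = e^{−2λ}` (the card's `X`). [cite: ChruscielCosta2008, §6.4 (g(∂φ,∂φ) = e^{−2λ})] -/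
def gφφ (p : ℝ × ℝ) : ℝ := Real.exp (-2 * D.lam p)

/-- `g_tφ = g(T, Φ) = −v e^{−2λ}` (the card's `W`), read off from `e^{−2λ}(dφ − v dt)²`.
[cite: ChruscielCosta2008, §6.4] -/
def gtφ (p : ℝ × ℝ) : ℝ := -(D.v p) * Real.exp (-2 * D.lam p)

/-- `g_tt = g(T, T) = −ρ² e^{2λ} + v² e^{−2λ}` (the card's `λ`; positive exactly in the ergoregion).
[cite: ChruscielCosta2008, §6.4] -/
def gtt (p : ℝ × ℝ) : ℝ := -(p.1 ^ 2) * Real.exp (2 * D.lam p) + (D.v p) ^ 2 * Real.exp (-2 * D.lam p)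

/-- `U = λ + ln ρ`. [cite: ChruscielCosta2008, §6.4 (U = λ + ln ρ)] -/
def U (p : ℝ × ℝ) : ℝ := D.lam p + Real.log p.1

/-- The orbit-metric conformal factor `e^{2û}` (`q = e^{2û}(dρ² + dz²)`). [cite: ChruscielCosta2008, §6.4] -/
def orbitFactor (p : ℝ × ℝ) : ℝ := Real.exp (2 * D.uHat p)

/-- `Ξ := g_φφ / ρ²` (the card's `Ξ = X/ρ²`). [folklore] -/
def Xi (p : ℝ × ℝ) : ℝ := D.gφφ p / p.1 ^ 2

/-- The card's conformal factor `e^{2u} := g(T,T) · Ξ`. [folklore] -/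
def expTwoU (p : ℝ × ℝ) : ℝ := D.gtt p * D.Xi p

/-- The ergoregion in orbit space, `E₂ = {g(T,T) > 0}` (`T` spacelike), on which the zero-energy
optical metric lives. [folklore] -/
def ergoRegion : Set (ℝ × ℝ) := {p ∈ weylHalfPlane | 0 < D.gtt p}

/-- The conformal factor of the **zero-energy optical metric** `J = (g(T,T)/ρ²) q`,
`q = e^{2û}(dρ² + dz²)`: `g_tt e^{2û} / ρ²`. [folklore] -/
def opticalFactor (p : ℝ × ℝ) : ℝ := D.gtt p * D.orbitFactor p / p.1 ^ 2

/-! ### Identities -/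

/-- **`ρ² = W² − g(T,T)·X`**: minus the determinant of the Gram matrix of `(T, Φ)` is `ρ²` — the
defining property of the Weyl coordinate `ρ` (area density of the Killing orbits), here a
consequence of the Weyl–Papapetrou form. [cite: ChruscielCosta2008, §6.3–6.4] -/
theorem gram_det (p : ℝ × ℝ) : D.gtφ p ^ 2 - D.gtt p * D.gφφ p = p.1 ^ 2 := by
  simp only [gtφ, gtt, gφφ]
  have h : Real.exp (2 * D.lam p) * Real.exp (-2 * D.lam p) = 1 := by
    rw [← Real.exp_add]; simp
  nlinarith [h, Real.exp_pos (2 * D.lam p), Real.exp_pos (-2 * D.lam p)]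

/-- `g_φφ = e^{−2λ} > 0` off the axis. [cite: ChruscielCosta2008, §6.4] -/
theorem gφφ_pos (p : ℝ × ℝ) : 0 < D.gφφ p := Real.exp_pos _

/-- `g(∂φ,∂φ) = ρ² e^{−2U}` for `ρ > 0` (Chruściel–Costa's relation between `U` and `λ`).
[cite: ChruscielCosta2008, §6.4 (g(∂φ,∂φ) = ρ² e^{−2U} = e^{−2λ})] -/
theorem gφφ_eq_sq_mul_exp {p : ℝ × ℝ} (hp : p ∈ weylHalfPlane) :
    D.gφφ p = p.1 ^ 2 * Real.exp (-2 * D.U p) := by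
  have hρ : 0 < p.1 := hp
  have h2 : Real.exp (-2 * (D.lam p + Real.log p.1)) = Real.exp (-2 * D.lam p) / p.1 ^ 2 := by
    rw [show -2 * (D.lam p + Real.log p.1) = -2 * D.lam p - (Real.log p.1 + Real.log p.1) by ring,
      Real.exp_sub, Real.exp_add, Real.exp_log hρ, sq]
  simp only [gφφ, U]
  rw [h2]
  field_simp

/-- The optical factor is `e^{2u} e^{2û} e^{2λ}`… concretely `opticalFactor = expTwoU · e^{2û} · e^{2λ}`
(all the `ρ`-dependence sits in `Ξ`). [folklore] -/
theorem opticalFactor_eq (p : ℝ × ℝ) :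
    D.opticalFactor p = D.expTwoU p * D.orbitFactor p * Real.exp (2 * D.lam p) := by
  have h : Real.exp (-2 * D.lam p) * Real.exp (2 * D.lam p) = 1 := by
    rw [← Real.exp_add]; simp
  simp only [opticalFactor, expTwoU, Xi, gφφ, orbitFactor]
  rw [show D.gtt p * (Real.exp (-2 * D.lam p) / p.1 ^ 2) * Real.exp (2 * D.uHat p) *
      Real.exp (2 * D.lam p) = D.gtt p * Real.exp (2 * D.uHat p) / p.1 ^ 2 *
      (Real.exp (-2 * D.lam p) * Real.exp (2 * D.lam p)) by ring, h, mul_one]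

/-- On the ergoregion the optical factor is positive (`J` is Riemannian there). [folklore] -/
theorem opticalFactor_pos {p : ℝ × ℝ} (hp : p ∈ D.ergoRegion) : 0 < D.opticalFactor p := by
  have hρ : (0 : ℝ) < p.1 := hp.1
  have hg : 0 < D.gtt p := hp.2
  simp only [opticalFactor, orbitFactor]
  positivity

end WeylPapapetrouData

end Literature.Geometry.Lorentzian

end
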